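import Summits.SmoothPoincare4.SmoothPoincare4.Theorems.EntropyRungConicalGapGradScalarBound
import Summits.SmoothPoincare4.SmoothPoincare4.Theorems.EntropyRungConicalGapWeightedMoments
import Summits.SmoothPoincare4.SmoothPoincare4.Theorems.EntropyRungConicalGapRicciMomentIdentity
import Literature.Geometry.Lorentzian.DalembertianCompose
import Literature.Geometry.Lorentzian.ChartLaplacian
import HarnessLib

/-!
# Helper `helper_gradScalar_weightedIdentity` of line `Sketch`
(crux `EntropyRung.ConicalGap`, stmt-SmoothPoincare4-16589)

The **weighted Bochner identity for the scalar curvature at every scale**, `n = 4`: on a complete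
connected normalised gradient shrinking Ricci soliton `(M⁴, g, f)` (`Ric + Hess f = g/2`,
`R + |∇f|² = f`, closed `g`-balls compact), GIVEN that `|Ric|² e^{-f/σ}` is integrable for every
`σ > 0`, for every `τ > 0`, writing `v = e^{-f/τ}`, `N = |Ric|²`, `X = g⁻¹(dR, df)` and all
integrals w.r.t. `dV`, the weight `|∇R|² v` is integrable and

  `∫ |∇R|² v = 2 ∫ R N v − ∫ R² v − (1 − τ⁻¹) ∫ R X v`.

Ingredients, all theorems of the tree:

* Hamilton's identity `Δ R = X + R − 2N` (`dalembertian_scalarCurvature_of_soliton`,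
  Munteanu–Wang 2016, §2), and the chain rules `Δ(R²/2) = |∇R|² + R ΔR`
  (`dalembertian_real_comp`), `d(R²/2) = R dR` (`mvfderiv_real_comp_apply`),
  `g⁻¹(dρ, dv) = −τ⁻¹ v g⁻¹(dρ, df)` (`weightedIdentity_innerDual_mvfderiv_expNegDiv`);
* Green's first identity along the proper exhaustion `f`
  (`CarrilloNi2009_shrinkerLSI.integral_mul_dalembertian_eq_neg_integral_innerDual_of_proper`)
  with `u = v`, `w = R²/2`: `∫ v Δ(R²/2) = −∫ g⁻¹(dv, d(R²/2)) = τ⁻¹ ∫ R X v`, whose left side is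
  `∫ |∇R|² v + ∫ R X v + ∫ R² v − 2 ∫ R N v`;
* the a-priori integrability: `|∇R|² ≤ 4 N |∇f|² ≤ 4 f N` (`gradScalarBound_gradSq_le`,
  `|∇f|² = f − R ≤ f`), `|X| ≤ N + (|∇f|²)² ≤ N + f²` (`gradScalarBound_innerDual_sq_le`), so
  `|R X| v ≤ f N v + f³ v`; the moments `f^k N v`, `f^k v`, `R N v`
  (`weightedMoments_integrable_pow_mul_normSq`, `weightedMoments_integrable_pow`,
  `weightedMoments_integrable_pow_mul_scalarCurvature_mul_normSq`) and `R² v`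
  (`ricciMoment_integrable_sq`); properness of `f` and `R ≥ 0`
  (`NoncompactShrinkerGapCarrilloNiClauses.scalarCurvature_nonneg_and_isCompact_sublevel`).

Everything here is proved; no definition and no named fact is introduced.

## References

* O. Munteanu, N. Sesum, *On gradient Ricci solitons*, J. Geom. Anal. 23 (2013) 539–561,
  proof of Thm. 1.5 (`∫ |∇R|² e^{-f} < ∞`, `∫ |Ric|² e^{-λf} < ∞`). [MunteanuSesum2013]
* O. Munteanu, J. Wang, *Structure at infinity for shrinking Ricci solitons*, arXiv:1606.01861,
  §2 (p. 6). [MunteanuWang2016]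
* [CarrilloNi2009] J. Carrillo, L. Ni, Comm. Anal. Geom. 17 (2009) 721–753, §4.
-/

noncomputable section

-- `Summit.SmoothPoincare4.SmoothPoincare4.…` (summit = problem) trips `dupNamespace` on every decl.
set_option linter.dupNamespace false

open scoped Manifold ContDiff ENNReal NNReal Topology
open MeasureTheory Set Filter
open Literature.Geometry.Lorentzian Literature.Geometry.Riemannian

namespace Summit.SmoothPoincare4.SmoothPoincare4.Theorems.ConicalGapSketch

/-! ## The profile `ζ(t) = t²/2` on the real line -/

/-- `ζ(t) = t²/2` has derivative `ζ′(t) = t`. -/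
theorem gradScalar_hasDerivAt_halfSq (t : ℝ) : HasDerivAt (fun s : ℝ ↦ s ^ 2 / 2) t t := by
  refine ((hasDerivAt_pow 2 t).div_const 2).congr_deriv ?_
  norm_num

/-- `ζ′ = id` as functions. -/
theorem gradScalar_deriv_halfSq : deriv (fun s : ℝ ↦ s ^ 2 / 2) = fun t ↦ t :=
  funext fun t ↦ (gradScalar_hasDerivAt_halfSq t).deriv

/-- `ζ″(t) = 1`. -/
theorem gradScalar_deriv_deriv_halfSq (t : ℝ) : deriv (deriv fun s : ℝ ↦ s ^ 2 / 2) t = 1 := by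
  rw [gradScalar_deriv_halfSq]
  exact (hasDerivAt_id' t).deriv

/-! ## Pointwise chain rules for `R²/2` (any dimension) -/

section Pointwise

variable {n : ℕ} {M : Type*} [TopologicalSpace M] [ChartedSpace (EuclideanSpace ℝ (Fin n)) M]
  [IsManifold (𝓡 n) ∞ M]
  {g : PseudoRiemannianMetric (𝓡 n) ∞ (EuclideanSpace ℝ (Fin n)) (TangentSpace (𝓡 n) : M → Type _)}

/-- `d(u²/2) = u du` inside the inverse metric: `g⁻¹(dρ, d(u²/2)) = u g⁻¹(dρ, du)` (chain rule
`mvfderiv_real_comp_apply` with `ζ(t) = t²/2`). -/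
theorem gradScalar_innerDual_mvfderiv_halfSq {u ρ : M → ℝ} {x : M}
    (hux : MDifferentiableAt (𝓡 n) 𝓘(ℝ, ℝ) u x) :
    g.innerDual x (mvfderiv (𝓡 n) ρ x).toLinearMap
        (mvfderiv (𝓡 n) (fun y ↦ u y ^ 2 / 2) x).toLinearMap =
      u x * g.innerDual x (mvfderiv (𝓡 n) ρ x).toLinearMap (mvfderiv (𝓡 n) u x).toLinearMap := by
  have hd := gradScalar_hasDerivAt_halfSq (u x)
  have hlin : (mvfderiv (𝓡 n) (fun y ↦ u y ^ 2 / 2) x).toLinearMap =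
      u x • (mvfderiv (𝓡 n) u x).toLinearMap := by
    ext v
    have := mvfderiv_real_comp_apply (I := 𝓡 n) hd hux v
    simpa [Function.comp_def] using this
  rw [hlin]
  simp only [PseudoRiemannianMetric.innerDual, map_smul, smul_eq_mul]

variable [g.HasLeviCivita]

/-- **`Δ(u²/2) = |∇u|² + u Δu`** for `u` of class `C²` at `x`: the chain rule
`Δ(ζ ∘ u) = ζ″(u)|∇u|² + ζ′(u) Δu` (`dalembertian_real_comp`) with `ζ(t) = t²/2`. -/
theorem gradScalar_dalembertian_halfSq {u : M → ℝ} {x : M}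
    (hux : ContMDiffAt (𝓡 n) 𝓘(ℝ, ℝ) 2 u x) :
    g.dalembertian (fun y ↦ u y ^ 2 / 2) x = g.gradSq u x + u x * g.dalembertian u x := by
  have hζ : ContDiffAt ℝ 2 (fun t : ℝ ↦ t ^ 2 / 2) (u x) :=
    ((contDiff_id.pow 2).div_const 2).contDiffAt
  have hcomp := g.dalembertian_real_comp (ζ := fun t : ℝ ↦ t ^ 2 / 2) hux hζ
  rw [show (fun y ↦ u y ^ 2 / 2) = (fun t : ℝ ↦ t ^ 2 / 2) ∘ u from rfl, hcomp,
    gradScalar_deriv_deriv_halfSq, (gradScalar_hasDerivAt_halfSq (u x)).deriv, one_mul]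
  rfl

end Pointwise

/-! ## The weighted Bochner identity on a proper normalised shrinker (any dimension) -/

section ProperGreen

variable {n : ℕ} {M : Type*} [TopologicalSpace M] [ChartedSpace (EuclideanSpace ℝ (Fin n)) M]
  [IsManifold (𝓡 n) ∞ M] [T3Space M] [MeasurableSpace M] [BorelSpace M]
  {g : PseudoRiemannianMetric (𝓡 n) ∞ (EuclideanSpace ℝ (Fin n)) (TangentSpace (𝓡 n) : M → Type _)}
  {f : M → ℝ} [g.HasLeviCivita]

/-- **`|∇R|² e^{-f/τ}` is integrable for every `τ > 0`, GIVEN that `|Ric|² e^{-f/σ}` is integrable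
for every `σ > 0`**, on a normalised gradient shrinker with `R ≥ 0`, over `g.riemVolume`:
`0 ≤ |∇R|² ≤ 4 |Ric|² |∇f|² ≤ 4 f |Ric|²` (`gradScalarBound_gradSq_le`, `|∇f|² = f − R ≤ f`),
and `f |Ric|² e^{-f/τ}` is integrable (`weightedMoments_integrable_pow_mul_normSq`, `k = 1`);
`|∇R|² = g⁻¹(dR, dR)` is continuous (`continuous_innerDual_mvfderiv`). -/
theorem gradScalar_integrable_gradSq (hg : g.IsRiemannian) (hf : ContMDiff (𝓡 n) 𝓘(ℝ, ℝ) ∞ f)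
    (hsol : ∀ (x : M) (X Y : TangentSpace (𝓡 n) x),
      g.ricci x X Y + g.hessian f x X Y = (1 / 2 : ℝ) * g.val x X Y)
    (hnorm : ∀ x : M, g.scalarCurvature x + g.gradSq f x = f x)
    (hR0 : ∀ x, 0 ≤ g.scalarCurvature x)
    (hRic : ∀ σ : ℝ, 0 < σ →
      Integrable (fun x ↦ g.normSq x (g.ricci x) * Real.exp (-f x / σ)) g.riemVolume)
    {τ : ℝ} (hτ : 0 < τ) :
    Integrable (fun x ↦ g.gradSq g.scalarCurvature x * Real.exp (-f x / τ)) g.riemVolume := by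
  have hf0 : ∀ x, 0 ≤ f x := fun x ↦ by linarith [hnorm x, hR0 x, g.gradSq_nonneg hg f x]
  have hBle : ∀ x, g.gradSq f x ≤ f x := fun x ↦ by linarith [hnorm x, hR0 x]
  have hQ0 : ∀ x, 0 ≤ g.normSq x (g.ricci x) := fun x ↦ g.normSq_nonneg x hg _
  have hE : Continuous fun x ↦ Real.exp (-f x / τ) :=
    Real.continuous_exp.comp (hf.continuous.neg.div_const _)
  have hS1 : ContMDiff (𝓡 n) 𝓘(ℝ, ℝ) 1 g.scalarCurvature :=
    (PseudoRiemannianMetric.contMDiff_scalarCurvature g).of_le ENat.LEInfty.out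
  have hGc : Continuous fun x ↦ g.gradSq g.scalarCurvature x :=
    continuous_innerDual_mvfderiv g hS1 hS1
  refine ((weightedMoments_integrable_pow_mul_normSq hg hf hnorm hR0 hRic 1 hτ).const_mul 4).mono
    (hGc.mul hE).aestronglyMeasurable (Eventually.of_forall fun x ↦ ?_)
  rw [Real.norm_eq_abs, Real.norm_eq_abs,
    abs_of_nonneg (mul_nonneg (g.gradSq_nonneg hg _ x) (Real.exp_pos _).le),
    abs_of_nonneg (mul_nonneg (by norm_num) (mul_nonneg (mul_nonneg (pow_nonneg (hf0 x) 1)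
      (hQ0 x)) (Real.exp_pos _).le)), pow_one]
  have h1 : g.gradSq g.scalarCurvature x ≤ 4 * g.normSq x (g.ricci x) * f x :=
    (gradScalarBound_gradSq_le hg hf hsol x).trans
      (mul_le_mul_of_nonneg_left (hBle x) (mul_nonneg (by norm_num) (hQ0 x)))
  calc g.gradSq g.scalarCurvature x * Real.exp (-f x / τ)
      ≤ 4 * g.normSq x (g.ricci x) * f x * Real.exp (-f x / τ) :=
        mul_le_mul_of_nonneg_right h1 (Real.exp_pos _).le
    _ = 4 * (f x * g.normSq x (g.ricci x) * Real.exp (-f x / τ)) := by ring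

/-- **`R g⁻¹(dR, df) e^{-f/τ}` is integrable for every `τ > 0`, GIVEN that `|Ric|² e^{-f/σ}` is
integrable for every `σ > 0`**, on a gradient shrinker with proper potential and `R ≥ 0`, over
`g.riemVolume`: `g⁻¹(dR, df)² ≤ 4 |Ric|² (|∇f|²)²` (`gradScalarBound_innerDual_sq_le`) gives
`|g⁻¹(dR, df)| ≤ |Ric|² + (|∇f|²)² ≤ |Ric|² + f²`, and `0 ≤ R ≤ f`, so
`|R g⁻¹(dR, df)| e^{-f/τ} ≤ f |Ric|² e^{-f/τ} + f³ e^{-f/τ}`, integrable by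
`weightedMoments_integrable_pow_mul_normSq` (`k = 1`) and `weightedMoments_integrable_pow`
(`k = 3`). -/
theorem gradScalar_integrable_scalarCurvature_mul_innerDual (hg : g.IsRiemannian)
    (hf : ContMDiff (𝓡 n) 𝓘(ℝ, ℝ) ∞ f)
    (hsol : ∀ (x : M) (X Y : TangentSpace (𝓡 n) x),
      g.ricci x X Y + g.hessian f x X Y = (1 / 2 : ℝ) * g.val x X Y)
    (hnorm : ∀ x : M, g.scalarCurvature x + g.gradSq f x = f x)
    (hprop : ∀ R : ℝ, IsCompact {x | f x ≤ R}) (hR0 : ∀ x, 0 ≤ g.scalarCurvature x)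
    (hRic : ∀ σ : ℝ, 0 < σ →
      Integrable (fun x ↦ g.normSq x (g.ricci x) * Real.exp (-f x / σ)) g.riemVolume)
    {τ : ℝ} (hτ : 0 < τ) :
    Integrable (fun x ↦ g.scalarCurvature x *
      g.innerDual x (mvfderiv (𝓡 n) g.scalarCurvature x).toLinearMap
        (mvfderiv (𝓡 n) f x).toLinearMap * Real.exp (-f x / τ)) g.riemVolume := by
  have hf0 : ∀ x, 0 ≤ f x := fun x ↦ by linarith [hnorm x, hR0 x, g.gradSq_nonneg hg f x]
  have hRle : ∀ x, g.scalarCurvature x ≤ f x := fun x ↦ by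
    linarith [hnorm x, g.gradSq_nonneg hg f x]
  have hB0 : ∀ x, 0 ≤ g.gradSq f x := fun x ↦ g.gradSq_nonneg hg f x
  have hBle : ∀ x, g.gradSq f x ≤ f x := fun x ↦ by linarith [hnorm x, hR0 x]
  have hQ0 : ∀ x, 0 ≤ g.normSq x (g.ricci x) := fun x ↦ g.normSq_nonneg x hg _
  -- `|g⁻¹(dR, df)| ≤ |Ric|² + f²`
  have hXabs : ∀ x, |g.innerDual x (mvfderiv (𝓡 n) g.scalarCurvature x).toLinearMap
      (mvfderiv (𝓡 n) f x).toLinearMap| ≤ g.normSq x (g.ricci x) + f x ^ 2 := fun x ↦ by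
    have h := gradScalarBound_innerDual_sq_le hg hf hsol x
    have h1 : |g.innerDual x (mvfderiv (𝓡 n) g.scalarCurvature x).toLinearMap
        (mvfderiv (𝓡 n) f x).toLinearMap| ≤ g.normSq x (g.ricci x) + g.gradSq f x ^ 2 :=
      abs_le_of_sq_le_sq
        (by nlinarith [h, sq_nonneg (g.normSq x (g.ricci x) - g.gradSq f x ^ 2)])
        (add_nonneg (hQ0 x) (sq_nonneg _))
    have h2 : g.gradSq f x ^ 2 ≤ f x ^ 2 := pow_le_pow_left₀ (hB0 x) (hBle x) 2
    linarith
  -- measurability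
  have hE : Continuous fun x ↦ Real.exp (-f x / τ) :=
    Real.continuous_exp.comp (hf.continuous.neg.div_const _)
  have hSc : Continuous fun x ↦ g.scalarCurvature x :=
    (PseudoRiemannianMetric.contMDiff_scalarCurvature g).continuous
  have hS1 : ContMDiff (𝓡 n) 𝓘(ℝ, ℝ) 1 g.scalarCurvature :=
    (PseudoRiemannianMetric.contMDiff_scalarCurvature g).of_le ENat.LEInfty.out
  have hf1 : ContMDiff (𝓡 n) 𝓘(ℝ, ℝ) 1 f := hf.of_le ENat.LEInfty.out
  have hXc : Continuous fun x ↦ g.innerDual x (mvfderiv (𝓡 n) g.scalarCurvature x).toLinearMap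
      (mvfderiv (𝓡 n) f x).toLinearMap :=
    continuous_innerDual_mvfderiv g hS1 hf1
  refine ((weightedMoments_integrable_pow_mul_normSq hg hf hnorm hR0 hRic 1 hτ).add
    (weightedMoments_integrable_pow hg hf hsol hnorm hprop hR0 3 hτ)).mono'
    ((hSc.mul hXc).mul hE).aestronglyMeasurable (Eventually.of_forall fun x ↦ ?_)
  rw [Real.norm_eq_abs, abs_mul, abs_mul, abs_of_nonneg (hR0 x),
    abs_of_nonneg (Real.exp_pos _).le]
  calc g.scalarCurvature x * |g.innerDual x (mvfderiv (𝓡 n) g.scalarCurvature x).toLinearMap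
        (mvfderiv (𝓡 n) f x).toLinearMap| * Real.exp (-f x / τ)
      ≤ f x * (g.normSq x (g.ricci x) + f x ^ 2) * Real.exp (-f x / τ) :=
        mul_le_mul_of_nonneg_right (mul_le_mul (hRle x) (hXabs x) (abs_nonneg _) (hf0 x))
          (Real.exp_pos _).le
    _ = f x ^ 1 * g.normSq x (g.ricci x) * Real.exp (-f x / τ) +
          f x ^ 3 * Real.exp (-f x / τ) := by ring

/-- **The weighted Bochner identity for `R` at scale `τ`, any dimension, over `g.riemVolume`**: on
a gradient shrinker `Ric + Hess f = g/2` normalised by `R + |∇f|² = f`, with proper potential and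
`R ≥ 0`, GIVEN that `|Ric|² e^{-f/σ}` is integrable for every `σ > 0`, for every `τ > 0` the
weight `|∇R|² e^{-f/τ}` is integrable (`gradScalar_integrable_gradSq`) and
`∫ |∇R|² e^{-f/τ} = 2 ∫ R |Ric|² e^{-f/τ} − ∫ R² e^{-f/τ} − (1 − τ⁻¹) ∫ R g⁻¹(dR, df) e^{-f/τ}`:
Green's first identity along the proper exhaustion `f`
(`CarrilloNi2009_shrinkerLSI.integral_mul_dalembertian_eq_neg_integral_innerDual_of_proper`)
with `u = e^{-f/τ}`, `w = R²/2`, whose provisos are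
`e^{-f/τ} Δ(R²/2) = (|∇R|² + R g⁻¹(dR, df) + R² − 2 R |Ric|²) e^{-f/τ}`
(`gradScalar_dalembertian_halfSq`, Hamilton's `dalembertian_scalarCurvature_of_soliton`),
`g⁻¹(d e^{-f/τ}, d(R²/2)) = −τ⁻¹ R g⁻¹(dR, df) e^{-f/τ}` and
`e^{-f/τ} g⁻¹(df, d(R²/2)) = R g⁻¹(dR, df) e^{-f/τ}` (`gradScalar_innerDual_mvfderiv_halfSq`,
`weightedIdentity_innerDual_mvfderiv_expNegDiv`, `innerDual_comm`), all integrable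
(`gradScalar_integrable_scalarCurvature_mul_innerDual`, `ricciMoment_integrable_sq`,
`weightedMoments_integrable_pow_mul_scalarCurvature_mul_normSq`). -/
theorem gradScalar_weightedIdentity_riemVolume (hg : g.IsRiemannian)
    (hf : ContMDiff (𝓡 n) 𝓘(ℝ, ℝ) ∞ f)
    (hsol : ∀ (x : M) (X Y : TangentSpace (𝓡 n) x),
      g.ricci x X Y + g.hessian f x X Y = (1 / 2 : ℝ) * g.val x X Y)
    (hnorm : ∀ x : M, g.scalarCurvature x + g.gradSq f x = f x)
    (hprop : ∀ R : ℝ, IsCompact {x | f x ≤ R}) (hR0 : ∀ x, 0 ≤ g.scalarCurvature x)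
    (hRic : ∀ σ : ℝ, 0 < σ →
      Integrable (fun x ↦ g.normSq x (g.ricci x) * Real.exp (-f x / σ)) g.riemVolume)
    {τ : ℝ} (hτ : 0 < τ) :
    Integrable (fun x ↦ g.gradSq g.scalarCurvature x * Real.exp (-f x / τ)) g.riemVolume ∧
      ∫ x, g.gradSq g.scalarCurvature x * Real.exp (-f x / τ) ∂g.riemVolume =
        2 * (∫ x, g.scalarCurvature x * g.normSq x (g.ricci x) * Real.exp (-f x / τ)
            ∂g.riemVolume) -
          (∫ x, g.scalarCurvature x ^ 2 * Real.exp (-f x / τ) ∂g.riemVolume) -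
          (1 - τ⁻¹) * ∫ x, g.scalarCurvature x *
            g.innerDual x (mvfderiv (𝓡 n) g.scalarCurvature x).toLinearMap
              (mvfderiv (𝓡 n) f x).toLinearMap * Real.exp (-f x / τ) ∂g.riemVolume := by
  have iG := gradScalar_integrable_gradSq hg hf hsol hnorm hR0 hRic hτ
  have iRX := gradScalar_integrable_scalarCurvature_mul_innerDual hg hf hsol hnorm hprop hR0 hRic hτ
  have iR2 := ricciMoment_integrable_sq hg hf hsol hnorm hprop hR0 hτ
  have iRN : Integrable (fun x ↦ g.scalarCurvature x * g.normSq x (g.ricci x) *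
      Real.exp (-f x / τ)) g.riemVolume :=
    (weightedMoments_integrable_pow_mul_scalarCurvature_mul_normSq hg hf hnorm hR0 hRic 0 hτ).congr
      (Eventually.of_forall fun x ↦ by simp only [pow_zero, one_mul])
  refine ⟨iG, ?_⟩
  -- regularity: `e^{-f/τ} ∈ C¹`, `R²/2 ∈ C²`
  have hv1 : ContMDiff (𝓡 n) 𝓘(ℝ, ℝ) 1 (fun y ↦ Real.exp (-f y / τ)) :=
    ((Real.contDiff_exp.comp (contDiff_neg.div_const τ)).comp_contMDiff hf).of_le ENat.LEInfty.out
  have hS : ContMDiff (𝓡 n) 𝓘(ℝ, ℝ) ∞ g.scalarCurvature :=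
    PseudoRiemannianMetric.contMDiff_scalarCurvature g
  have hS2 : ContMDiff (𝓡 n) 𝓘(ℝ, ℝ) 2 g.scalarCurvature := hS.of_le ENat.LEInfty.out
  have hw2 : ContMDiff (𝓡 n) 𝓘(ℝ, ℝ) 2 (fun y ↦ g.scalarCurvature y ^ 2 / 2) :=
    (((contDiff_id.pow 2).div_const (2 : ℝ)).comp_contMDiff hS).of_le ENat.LEInfty.out
  have hSx : ∀ x, MDifferentiableAt (𝓡 n) 𝓘(ℝ, ℝ) g.scalarCurvature x := fun x ↦
    hS.mdifferentiableAt (by norm_num)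
  have hfx : ∀ x, MDifferentiableAt (𝓡 n) 𝓘(ℝ, ℝ) f x := fun x ↦
    hf.mdifferentiableAt (by norm_num)
  -- pointwise `e^{-f/τ} Δ(R²/2)` (chain rule and Hamilton's identity)
  have hpt : ∀ x, Real.exp (-f x / τ) * g.dalembertian (fun y ↦ g.scalarCurvature y ^ 2 / 2) x =
      g.gradSq g.scalarCurvature x * Real.exp (-f x / τ) +
        g.scalarCurvature x * g.innerDual x (mvfderiv (𝓡 n) g.scalarCurvature x).toLinearMap
          (mvfderiv (𝓡 n) f x).toLinearMap * Real.exp (-f x / τ) +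
        g.scalarCurvature x ^ 2 * Real.exp (-f x / τ) -
        2 * (g.scalarCurvature x * g.normSq x (g.ricci x) * Real.exp (-f x / τ)) := fun x ↦ by
    rw [gradScalar_dalembertian_halfSq hS2.contMDiffAt,
      dalembertian_scalarCurvature_of_soliton g hf hsol x]
    ring
  have iA : Integrable (fun x ↦ g.gradSq g.scalarCurvature x * Real.exp (-f x / τ) +
      g.scalarCurvature x * g.innerDual x (mvfderiv (𝓡 n) g.scalarCurvature x).toLinearMap
        (mvfderiv (𝓡 n) f x).toLinearMap * Real.exp (-f x / τ)) g.riemVolume := iG.add iRX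
  have iB : Integrable (fun x ↦ g.gradSq g.scalarCurvature x * Real.exp (-f x / τ) +
      g.scalarCurvature x * g.innerDual x (mvfderiv (𝓡 n) g.scalarCurvature x).toLinearMap
        (mvfderiv (𝓡 n) f x).toLinearMap * Real.exp (-f x / τ) +
      g.scalarCurvature x ^ 2 * Real.exp (-f x / τ)) g.riemVolume := iA.add iR2
  have iC : Integrable (fun x ↦ 2 * (g.scalarCurvature x * g.normSq x (g.ricci x) *
      Real.exp (-f x / τ))) g.riemVolume := iRN.const_mul 2
  have iD : Integrable (fun x ↦ g.gradSq g.scalarCurvature x * Real.exp (-f x / τ) +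
      g.scalarCurvature x * g.innerDual x (mvfderiv (𝓡 n) g.scalarCurvature x).toLinearMap
        (mvfderiv (𝓡 n) f x).toLinearMap * Real.exp (-f x / τ) +
      g.scalarCurvature x ^ 2 * Real.exp (-f x / τ) -
      2 * (g.scalarCurvature x * g.normSq x (g.ricci x) * Real.exp (-f x / τ))) g.riemVolume :=
    iB.sub iC
  have huΔ : Integrable (fun x ↦ Real.exp (-f x / τ) *
      g.dalembertian (fun y ↦ g.scalarCurvature y ^ 2 / 2) x) g.riemVolume :=
    iD.congr (Eventually.of_forall fun x ↦ (hpt x).symm)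
  -- pointwise `g⁻¹(d e^{-f/τ}, d(R²/2)) = -τ⁻¹ R g⁻¹(dR, df) e^{-f/τ}`
  have hduw_pt : ∀ x, g.innerDual x (mvfderiv (𝓡 n) (fun y ↦ Real.exp (-f y / τ)) x).toLinearMap
      (mvfderiv (𝓡 n) (fun y ↦ g.scalarCurvature y ^ 2 / 2) x).toLinearMap =
      -τ⁻¹ * (g.scalarCurvature x *
        g.innerDual x (mvfderiv (𝓡 n) g.scalarCurvature x).toLinearMap
          (mvfderiv (𝓡 n) f x).toLinearMap * Real.exp (-f x / τ)) := fun x ↦ by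
    rw [gradScalar_innerDual_mvfderiv_halfSq (hSx x), g.innerDual_comm x,
      weightedIdentity_innerDual_mvfderiv_expNegDiv τ (hfx x)]
    ring
  have hduw : Integrable (fun x ↦ g.innerDual x
      (mvfderiv (𝓡 n) (fun y ↦ Real.exp (-f y / τ)) x).toLinearMap
      (mvfderiv (𝓡 n) (fun y ↦ g.scalarCurvature y ^ 2 / 2) x).toLinearMap) g.riemVolume :=
    (iRX.const_mul (-τ⁻¹)).congr (Eventually.of_forall fun x ↦ (hduw_pt x).symm)
  -- pointwise `e^{-f/τ} g⁻¹(df, d(R²/2)) = R g⁻¹(dR, df) e^{-f/τ}`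
  have hcross_pt : ∀ x, Real.exp (-f x / τ) * g.innerDual x (mvfderiv (𝓡 n) f x).toLinearMap
      (mvfderiv (𝓡 n) (fun y ↦ g.scalarCurvature y ^ 2 / 2) x).toLinearMap =
      g.scalarCurvature x * g.innerDual x (mvfderiv (𝓡 n) g.scalarCurvature x).toLinearMap
        (mvfderiv (𝓡 n) f x).toLinearMap * Real.exp (-f x / τ) := fun x ↦ by
    rw [gradScalar_innerDual_mvfderiv_halfSq (hSx x), g.innerDual_comm x]
    ring
  have hcross : Integrable (fun x ↦ Real.exp (-f x / τ) * g.innerDual x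
      (mvfderiv (𝓡 n) f x).toLinearMap
      (mvfderiv (𝓡 n) (fun y ↦ g.scalarCurvature y ^ 2 / 2) x).toLinearMap) g.riemVolume :=
    iRX.congr (Eventually.of_forall fun x ↦ (hcross_pt x).symm)
  have hG :=
    CarrilloNi2009_shrinkerLSI.integral_mul_dalembertian_eq_neg_integral_innerDual_of_proper hg hf
      hprop hv1 hw2 huΔ hduw hcross
  -- evaluate both sides
  have hI1 : ∫ x, Real.exp (-f x / τ) *
      g.dalembertian (fun y ↦ g.scalarCurvature y ^ 2 / 2) x ∂g.riemVolume =
      (∫ x, g.gradSq g.scalarCurvature x * Real.exp (-f x / τ) ∂g.riemVolume) +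
        (∫ x, g.scalarCurvature x *
          g.innerDual x (mvfderiv (𝓡 n) g.scalarCurvature x).toLinearMap
            (mvfderiv (𝓡 n) f x).toLinearMap * Real.exp (-f x / τ) ∂g.riemVolume) +
        (∫ x, g.scalarCurvature x ^ 2 * Real.exp (-f x / τ) ∂g.riemVolume) -
        2 * (∫ x, g.scalarCurvature x * g.normSq x (g.ricci x) * Real.exp (-f x / τ)
          ∂g.riemVolume) := by
    simp_rw [hpt]
    rw [integral_sub iB iC, integral_add iA iR2, integral_add iG iRX, integral_const_mul]
  have hI2 : ∫ x, g.innerDual x (mvfderiv (𝓡 n) (fun y ↦ Real.exp (-f y / τ)) x).toLinearMap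
      (mvfderiv (𝓡 n) (fun y ↦ g.scalarCurvature y ^ 2 / 2) x).toLinearMap ∂g.riemVolume =
      -τ⁻¹ * ∫ x, g.scalarCurvature x *
        g.innerDual x (mvfderiv (𝓡 n) g.scalarCurvature x).toLinearMap
          (mvfderiv (𝓡 n) f x).toLinearMap * Real.exp (-f x / τ) ∂g.riemVolume := by
    simp_rw [hduw_pt]
    rw [integral_const_mul]
  rw [hI1, hI2] at hG
  linear_combination hG

end ProperGreen

/-! ## The registered helper -/

/-- **Helper `helper_gradScalar_weightedIdentity` of line `Sketch`** (the weighted Bochner identity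
for the scalar curvature at every scale, `n = 4`): on every complete connected normalised 4-d
gradient shrinking Ricci soliton, GIVEN that `|Ric|² e^{-f/σ}` is integrable for every `σ > 0`,
for every `τ > 0` the weight `|∇R|² e^{-f/τ}` is integrable and
`∫ |∇R|² e^{-f/τ} dV = 2 ∫ R |Ric|² e^{-f/τ} dV − ∫ R² e^{-f/τ} dV
  − (1 − τ⁻¹) ∫ R g⁻¹(dR, df) e^{-f/τ} dV`
(`dV` the Riemannian measure of `g.toContMDiffRiemannianMetric hg`, to which `g.riemVolume`
unfolds by `riemVolume_eq`): `R ≥ 0` and properness of `f`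
(`NoncompactShrinkerGapCarrilloNiClauses.scalarCurvature_nonneg_and_isCompact_sublevel`), then
`gradScalar_weightedIdentity_riemVolume`. -/
theorem helper_gradScalar_weightedIdentity : ∀ (M : Type) [TopologicalSpace M] [T2Space M] [SecondCountableTopology M] [ChartedSpace (EuclideanSpace ℝ (Fin 4)) M] [IsManifold (𝓡 4) ∞ M] [ConnectedSpace M] [T3Space M] [MeasurableSpace M] [BorelSpace M] (g : Literature.Geometry.Lorentzian.PseudoRiemannianMetric (𝓡 4) ∞ (EuclideanSpace ℝ (Fin 4)) (TangentSpace (𝓡 4) : M → Type _)) [g.HasLeviCivita] (f : M → ℝ) (hg : g.IsRiemannian), (∀ (x : M) (r : NNReal), IsCompact {y : M | g.edist hg x y ≤ r}) → ContMDiff (𝓡 4) 𝓘(ℝ, ℝ) ∞ f → (∀ (x : M) (X Y : TangentSpace (𝓡 4) x), g.ricci x X Y + g.hessian f x X Y = (1 / 2 : ℝ) * g.val x X Y) → (∀ x : M, g.scalarCurvature x + g.gradSq f x = f x) → (∀ σ : ℝ, 0 < σ → MeasureTheory.Integrable (fun x ↦ g.normSq x (g.ricci x) * Real.exp (-f x /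 σ)) (Literature.Geometry.Lorentzian.riemannianMeasure (g.toContMDiffRiemannianMetric hg))) → ∀ τ : ℝ, 0 < τ → MeasureTheory.Integrable (fun x ↦ g.gradSq g.scalarCurvature x * Real.exp (-f x / τ)) (Literature.Geometry.Lorentzian.riemannianMeasure (g.toContMDiffRiemannianMetric hg)) ∧ ∫ x, g.gradSq g.scalarCurvature x * Real.exp (-f x / τ) ∂(Literature.Geometry.Lorentzian.riemannianMeasure (g.toContMDiffRiemannianMetric hg)) = 2 * (∫ x, g.scalarCurvature x * g.normSq x (g.ricci x) * Real.exp (-f x / τ) ∂(Literature.Geometry.Lorentzian.riemannianMeasure (g.toContMDiffRiemannianMetric hg))) - (∫ x, g.scalarCurvature x ^ 2 * Real.exp (-f x / τ) ∂(Literature.Geometry.Lorentzian.riemannianMeasure (g.toContMDiffRiemannianMetric hg))) - (1 - τ⁻¹) * ∫ x, g.scalarCurvature x * g.innerDual x (mvfderiv (𝓡 4) g.scalarCurvature x).toLinearMap (mvfderiv (𝓡 4) f x).toLinearMap * Real.exp (-f x / τ) ∂(Literature.Geometry.Lorentzian.riemannianMeasure (g.toContMDiffRiemannianMetric hg)) :=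 by
  intro M _ _ _ _ _ _ _ _ _ g _ f hg hc hf hsol hnorm hRic τ hτ
  obtain ⟨hR0, -, hprop⟩ :=
    NoncompactShrinkerGapCarrilloNiClauses.scalarCurvature_nonneg_and_isCompact_sublevel g f hg hc hf
      hsol hnorm
  rw [← PseudoRiemannianMetric.riemVolume_eq hg] at hRic ⊢
  exact gradScalar_weightedIdentity_riemVolume hg hf hsol hnorm hprop hR0 hRic hτ

end Summit.SmoothPoincare4.SmoothPoincare4.Theorems.ConicalGapSketch

end
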